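import Literature.LinearAlgebra.Matrix.LatimerMacDuffeeRegularMatrices
import Literature.NumberTheory.ComplexMultiplication.CMAlgebraLatticeClassesFinite
import Literature.LinearAlgebra.DiagonalizableEigenspaces
import Mathlib.NumberTheory.NumberField.Basic
import Mathlib.Analysis.Complex.Polynomial.Basic
import Mathlib.FieldTheory.Perfect
import Mathlib.Algebra.Squarefree.Basic
import Mathlib.RingTheory.Ideal.Quotient.Operations
import HarnessLib

/-!
# Square-free characteristic polynomial ⟺ finitely many `GLₙ(ℤ)`-classes (Hertling–Larabi 2026b, Rem. 6.3 (iv))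

[topic LinearAlgebra/Matrix] Sequel to `LatimerMacDuffeeRegularMatrices` (Hertling–Larabi Theorem 6.2 = the
Latimer–MacDuffee correspondence for an arbitrary monic `g`). Source: C. Hertling, K. Larabi, arXiv:2602.15748
(2026) [HertlingLarabi2026b], §6 Remarks 6.3 (iv), chunk p0013:

«(iv) The following conditions are equivalent: (α) `A_f` is separable. (β) `f` does not have multiple roots in
`ℂ`. (γ) `M_f` is semisimple. (δ) Any regular matrix in `M_{n×n}(ℤ)` with characteristic polynomial `f` is
semisimple. (ε) `S_{1,f}` is finite. Here (α)⇒(ε) follows from Corollary 5.4. For the inverse implication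
(ε)⇒(α), Remark 5.11 (i) is needed.» — with Corollary 5.4 (chunk p0009): «Let `A` be separable. For any order
`Λ` in `A`, the set `{[L]_ε | L ∈ 𝓛(A), 𝒪(L) ⊃ Λ}` of `ε`-classes of `Λ`-ideals is finite.», the remark before
Theorem 4.8 (chunk p0007): «For separable `A` it follows easily, using the decomposition `A = ⊕_{j=1}^k A^{(j)}`
into algebraic number fields `A^{(j)}`.», and the introduction (chunk p0003): «The most prominent one is a
consequence of the Jordan-Zassenhaus theorem [Za38]. It says that the set of semisimple matrices in `M_{n×n}(ℤ)`
with a fixed characteristic polynomial splits into finitely many `GL_n(ℤ)`-conjugacy classes.»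

Here `S_{1,f}` is the set of `GLₙ(ℤ)`-conjugacy classes of regular integer matrices with characteristic polynomial
`f` (HL Thm. 6.2; in the tree: the quotient of `{B // minpoly_ℚ B = g}` by `PB = B′P`, `P` unimodular).

## What is formalised (`g ∈ ℚ[t]` monic, `A_g = ℚ[t]/(g) = AdjoinRoot g`, `θ = t̄`)

* §1 (β)⇒(δ) in the form that matters for `S_{1,f}`: a matrix over a field whose characteristic polynomial is
  square-free is regular, `minpoly = charpoly` (`minpoly_eq_charpoly_of_squarefree`; the tree's Adkins–Weintraub
  (4.32)); so for `f ∈ ℤ[t]` with square-free image in `ℚ[t]` the regular integer matrices with `p_B = f` are ALL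
  the integer matrices with `p_B = f` (`minpoly_map_eq_iff_charpoly_eq_of_squarefree`).
* §2 (β)⇒(α): for square-free `g`, the Chinese remainder theorem
  `A_g ≅ ∏_{p ∣ g, p monic irreducible} ℚ[t]/(p)` (`span_eq_iInf_span_normalizedFactors`,
  `nonempty_ringEquiv_pi_adjoinRoot`): `A_g` is a finite product of number fields.
* §3 Transport along a ring isomorphism `e : A ≃+* A′` (any rings): images of full lattices are full
  (`isFullLattice_map`), `e(uM) = e(u)e(M)`, and if the `ε`-classes of lattices with a property `P′` in `A′`
  are finite in number then so are those with any property `P` mapped into `P′` (`finite_quot_of_ringEquiv`).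
* §4 **(α)⇒(ε).** A full `θ`-stable lattice has a `ℤ`-basis representing an integer matrix (Thm. 6.2 (ii)), so
  `θ` is integral over `ℤ` (`isIntegral_root_of_isFullLattice`) and `Λ_g = ℤ[θ]` is a full lattice, an order
  (`isFullLattice_toSubmodule_adjoin`); `θ`-stable = `Λ_g`-stable («`t̄L ⊂ L`, so if and only if `𝒪(L) ⊃ Λ_f`»,
  `LatimerMacDuffeeRegular.forall_adjoin_mul_mem_iff`). Transporting to `∏ ℚ[t]/(p)` and applying the tree's
  HL 2026 THEOREM 6.3 ∕ Dade–Taussky–Zassenhaus finiteness for products of number fields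
  (`CMAlgebraLatticeClassesFinite.finite_quot_isFullLattice_of_isFullLattice`) gives:
  **for square-free monic `g` the `ε`-classes of full `θ`-stable lattices of `A_g` form a finite type**
  (`finite_quot_units_smul_of_squarefree`); hence, through Theorem 6.2
  (`LatimerMacDuffeeRegular.exists_equiv_quot_conj_quot_units_smul`), **`S_{1,g}` is finite**
  (`finite_quot_conj_of_squarefree`); and for `f ∈ ℤ[t]` monic of degree `n` with square-free image in `ℚ[t]`:
  **the integer `n × n` matrices with characteristic polynomial `f` lie in finitely many, and at least one,
  `GLₙ(ℤ)`-conjugacy classes** (`finite_quot_charpoly_conj_of_squarefree`, `natCard_quot_charpoly_conj_pos`;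
  with (β) «no multiple roots in `ℂ`» literally: `squarefree_map_iff_nodup_roots`,
  `finite_quot_charpoly_conj_of_nodup_roots`) —
  the square-free case of the consequence of Jordan–Zassenhaus quoted above, equivalently the case `h = m` of
  Marseglia's generalized Latimer–MacDuffee theorem («Let `m` be a squarefree polynomial in `ℤ[x]` […] Denote by
  `Mat_{m,h}` the set of integral square matrices with minimal polynomial `m` and characteristic polynomial `h`.
  Since `m` is squarefree, these matrices are semisimple. […] `Ψ` induces a bijection between the isomorphism
  classes in `𝓛(R, V)` and `Mat_{m,h}/∼_ℤ`», with `𝓛(R,V)` finite).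
* §5 **(ε)⇒(β)** («Remark 5.11 (i) is needed»): `ε`-equivalent ORDERS are equal
  (`eq_of_units_smul_eq_of_one_mem`); if `g` is not square-free, `A_g` has a nonzero `r` with `r² = 0`
  (`exists_ne_zero_mul_self_eq_zero`), and — Remark 5.11 (i) with the single nilpotent `r ∈ Λ_g` — the orders
  `Λ_m := Λ_g + 2^{-m} r Λ_g ⊇ Λ_g` (`sup_span_mul_mul_le`) are full `θ`-stable lattices which are not eventually
  equal (no full lattice contains every `2^{-m} r`), so **the `ε`-classes of full `θ`-stable lattices are
  INFINITE in number** (`infinite_quot_units_smul_of_not_squarefree`), **`S_{1,f}` is infinite**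
  (`infinite_quot_conj_of_not_squarefree`), and altogether **(β)⟺(ε): `S_{1,f}` is finite iff `f` has no
  multiple roots** (`finite_quot_conj_iff_squarefree`, `finite_quot_conj_iff_nodup_roots`).
* §6 the remaining equivalences **(α)⟺(β)** (`isReduced_adjoinRoot_iff_squarefree`: `A_g` is reduced — «separable»,
  `R = 0` — iff `g` is square-free), **(γ)⟺(β)** (`isSemisimple_companion_iff_squarefree`), **(δ)⟺(β)**
  (`forall_isSemisimple_iff_squarefree`; semisimple = `Module.End.IsSemisimple` of the `ℚ`-linear map, ⟺ square-free
  minimal polynomial), and **REMARK 6.3 (iv) as one `List.TFAE`** (`isReduced_squarefree_isSemisimple_finite_tfae`).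
NOT here: Rem. 6.3 (v) (the partition of `S_{1,f}` by the order `𝒪(L) ⊃ Λ_f`).

## References
* [HertlingLarabi2026b] C. Hertling, K. Larabi, arXiv:2602.15748 (2026), §6 Rem. 6.3 (iv); Cor. 5.4;
  Rem. 5.11 (i); §1. [cite: HertlingLarabi2026b, §6 Rem. 6.3 (iv), chunk p0013]
* [LatimerMacduffee1933] C. G. Latimer, C. C. MacDuffee, *A correspondence between classes of ideals and classes
  of matrices*, Ann. of Math. 34 (1933) 313–316.
* [Marseglia2019] S. Marseglia, *Computing the ideal class monoid of an order*, J. Lond. Math. Soc. 101 (2020)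
  984–1007, Thm. 8.1 — restated as Thm. 4.1 of S. Marseglia, *Modules over orders, conjugacy classes of integral
  matrices, and abelian varieties over finite fields* (ANTS XVI), §4, chunk p0013.
  [cite: Marseglia2019, Thm. 8.1 (via ANTS XVI §4 Thm. 4.1, chunk p0013)]
* [DadeTausskyZassenhaus1962] E. C. Dade, O. Taussky, H. Zassenhaus, *On the theory of orders …*, Math. Ann. 148
  (1962) 31–64 (finiteness of lattice classes in a product of number fields; the tree's `CMAlgebraLatticeClassesFinite`).
-/

noncomputable section

open scoped Classical Pointwise
open Polynomial Module Submodule Matrix UniqueFactorizationMonoid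

namespace Literature.LinearAlgebra.Matrix.LatimerMacDuffeeSquarefree

open Literature.NumberTheory.Automorphic (IsFullLattice)
open Literature.LinearAlgebra.Matrix.LatimerMacDuffeeRegular

variable {n : ℕ} {g : ℚ[X]}

/-! ## §1 (β)⇒(δ): a square-free characteristic polynomial forces regularity -/

/-- **A square-free characteristic polynomial is the minimal polynomial** (so the matrix is regular, HL Def./Lemma
6.1 (c)(ii): «`B` is regular ⟺ p_{B,min} = p_B`»): the matrix form of the tree's Adkins–Weintraub (4.32)
`minpoly_eq_charpoly_of_squarefree_charpoly`. [cite: HertlingLarabi2026b, §6 Def./Lemma 6.1 (c) and Rem. 6.3 (iv) (β)⇒(δ), chunks p0012–p0013]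
[cite: AdkinsWeintraub1992, Ch. 4 (4.32) Corollary] -/
theorem minpoly_eq_charpoly_of_squarefree {K : Type*} [Field K] {m : Type*} [Fintype m] [DecidableEq m]
    (B : Matrix m m K) (h : Squarefree B.charpoly) : minpoly K B = B.charpoly := by
  rw [← Matrix.minpoly_toLin', ← Matrix.charpoly_toLin']
  rw [← Matrix.charpoly_toLin'] at h
  exact Literature.LinearAlgebra.minpoly_eq_charpoly_of_squarefree_charpoly _ h

/-- For an integer matrix `B` with characteristic polynomial `f` whose image in `ℚ[t]` is square-free («`f` does
not have multiple roots»), `minpoly_ℚ B = f`: `B` is «regular with `p_B = f`».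
[cite: HertlingLarabi2026b, §6 Rem. 6.3 (iv) (β)⇒(δ), chunk p0013] -/
theorem minpoly_map_eq_of_charpoly_eq {m : Type*} [Fintype m] [DecidableEq m] {f : ℤ[X]} {B : Matrix m m ℤ}
    (hc : B.charpoly = f) (hsq : Squarefree (f.map (Int.castRingHom ℚ))) :
    minpoly ℚ (B.map (Int.castRingHom ℚ)) = f.map (Int.castRingHom ℚ) := by
  have h : (B.map (Int.castRingHom ℚ)).charpoly = f.map (Int.castRingHom ℚ) := by
    rw [Matrix.charpoly_map, hc]
  have hsq' : Squarefree (B.map (Int.castRingHom ℚ)).charpoly := by rwa [h]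
  rw [minpoly_eq_charpoly_of_squarefree _ hsq', h]

/-- **When `f ∈ ℤ[t]` (monic of degree `n`) has no multiple roots, `S_{1,f}` is the set of classes of ALL
integer matrices with characteristic polynomial `f`**: `minpoly_ℚ B = f ⟺ p_B = f`.
[cite: HertlingLarabi2026b, §6 Thm. 6.2 and Rem. 6.3 (iv) (δ), chunks p0012–p0013] -/
theorem minpoly_map_eq_iff_charpoly_eq_of_squarefree {f : ℤ[X]} (hdeg : f.natDegree = n)
    (hsq : Squarefree (f.map (Int.castRingHom ℚ))) (B : Matrix (Fin n) (Fin n) ℤ) :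
    minpoly ℚ (B.map (Int.castRingHom ℚ)) = f.map (Int.castRingHom ℚ) ↔ B.charpoly = f :=
  ⟨fun h => ((minpoly_map_eq_iff_charpoly_eq_and_natDegree_eq hdeg B).1 h).1,
    fun h => minpoly_map_eq_of_charpoly_eq h hsq⟩

/-- **(β) as printed, «`f` does not have multiple roots in `ℂ`», is square-freeness of `f` in `ℚ[t]`**
(⟺ separability, `ℚ` being perfect; the roots are taken in the algebraically closed field `ℂ`).
[cite: HertlingLarabi2026b, §6 Rem. 6.3 (iv) (β), chunk p0013] -/
theorem squarefree_map_iff_nodup_roots {f : ℤ[X]} (hf : f ≠ 0) :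
    Squarefree (f.map (Int.castRingHom ℚ)) ↔ (f.map (Int.castRingHom ℂ)).roots.Nodup := by
  have hf' : f.map (Int.castRingHom ℚ) ≠ 0 :=
    (Polynomial.map_ne_zero_iff (Int.castRingHom ℚ).injective_int).2 hf
  rw [← PerfectField.separable_iff_squarefree,
    ← Polynomial.nodup_aroots_iff_of_splits (K := ℂ) hf' (IsAlgClosed.splits _), Polynomial.aroots_def,
    Polynomial.map_map, RingHom.eq_intCast' ((algebraMap ℚ ℂ).comp (Int.castRingHom ℚ))]

/-! ## §2 (β)⇒(α): `A_g` is a finite product of number fields (Chinese remainder theorem) -/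

/-- Distinct monic irreducible factors of `g` are coprime. [folklore] -/
private theorem isCoprime_of_mem_normalizedFactors {p q : ℚ[X]} (hp : p ∈ normalizedFactors g)
    (hq : q ∈ normalizedFactors g) (hne : p ≠ q) : IsCoprime p q := by
  refine (irreducible_of_normalized_factor p hp).coprime_iff_not_dvd.2 fun hdvd => hne ?_
  have hassoc : Associated p q :=
    ((irreducible_of_normalized_factor p hp).dvd_irreducible_iff_associated
      (irreducible_of_normalized_factor q hq)).1 hdvd
  rw [← normalize_normalized_factor p hp, ← normalize_normalized_factor q hq]
  exact normalize_eq_normalize hassoc.dvd hassoc.symm.dvd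

/-- A square-free `g ≠ 0` is, up to a unit, the product of its DISTINCT monic irreducible factors
(«`f` does not have multiple roots»). [cite: HertlingLarabi2026b, §6 Rem. 6.3 (iv) (β), chunk p0013] -/
theorem associated_prod_toFinset_normalizedFactors (hg0 : g ≠ 0) (hsq : Squarefree g) :
    Associated (∏ p ∈ (normalizedFactors g).toFinset, p) g := by
  have hnd : (normalizedFactors g).Nodup := (squarefree_iff_nodup_normalizedFactors hg0).1 hsq
  have h : ∏ p ∈ (normalizedFactors g).toFinset, p = (normalizedFactors g).prod := by
    rw [Finset.prod_multiset_count]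
    refine Finset.prod_congr rfl fun p hp => ?_
    rw [Multiset.count_eq_one_of_mem hnd (Multiset.mem_toFinset.1 hp), pow_one]
  rw [h]
  exact prod_normalizedFactors hg0

/-- For square-free `g`: `(g) = ⋂_p (p)` over the distinct monic irreducible factors `p` of `g`. [folklore]
[cite: HertlingLarabi2026b, §4 (before Thm. 4.8: «the decomposition `A = ⊕_j A^{(j)}` into algebraic number fields»), chunk p0007] -/
theorem span_eq_iInf_span_normalizedFactors (hg0 : g ≠ 0) (hsq : Squarefree g) :
    Ideal.span {g} = ⨅ i : ↥(normalizedFactors g).toFinset, Ideal.span {(i : ℚ[X])} := by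
  rw [Ideal.iInf_span_singleton fun i j hij => isCoprime_of_mem_normalizedFactors
      (Multiset.mem_toFinset.1 i.2) (Multiset.mem_toFinset.1 j.2) fun h => hij (Subtype.ext h),
    Finset.prod_coe_sort (normalizedFactors g).toFinset fun p => p]
  exact (Ideal.span_singleton_eq_span_singleton.2 (associated_prod_toFinset_normalizedFactors hg0 hsq)).symm

/-- **(β)⇒(α): for square-free `g` the algebra `A_g = ℚ[t]/(g)` is the product of the number fields `ℚ[t]/(p)`,
`p` running through the distinct monic irreducible factors of `g`** (Chinese remainder theorem; «`A_f` is
separable», «the decomposition `A = ⊕_{j=1}^k A^{(j)}` into algebraic number fields»).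
[cite: HertlingLarabi2026b, §6 Rem. 6.3 (iv) (β)⇒(α), chunk p0013; §4 before Thm. 4.8, chunk p0007] -/
theorem nonempty_ringEquiv_pi_adjoinRoot (hg0 : g ≠ 0) (hsq : Squarefree g) :
    Nonempty (AdjoinRoot g ≃+* Π i : ↥(normalizedFactors g).toFinset, AdjoinRoot (i : ℚ[X])) :=
  ⟨(Ideal.quotEquivOfEq (span_eq_iInf_span_normalizedFactors hg0 hsq)).trans
    (Ideal.quotientInfRingEquivPiQuotient _ fun i j hij =>
      (Ideal.isCoprime_span_singleton_iff _ _).2 (isCoprime_of_mem_normalizedFactors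
        (Multiset.mem_toFinset.1 i.2) (Multiset.mem_toFinset.1 j.2) fun h => hij (Subtype.ext h)))⟩

/-- The factors are irreducible, so each `ℚ[t]/(p)` is a number field (`Fact (Irreducible p)` feeds Mathlib's
`Field`/`NumberField (AdjoinRoot p)` instances). [folklore] -/
private theorem irreducible_coe_toFinset_normalizedFactors (i : ↥(normalizedFactors g).toFinset) :
    Irreducible (i : ℚ[X]) :=
  irreducible_of_normalized_factor _ (Multiset.mem_toFinset.1 i.2)

/-! ## §3 Transport of full lattices and of `ε`-classes along a ring isomorphism -/

section Transport

variable {A A' : Type*} [Ring A] [Ring A']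

/-- The image of a full lattice under a ring isomorphism is a full lattice. [folklore]
[cite: HertlingLarabi2026b, §4 Def. 4.1 (a), chunk p0007] -/
theorem isFullLattice_map (e : A ≃+* A') {M : Submodule ℤ A} (hM : IsFullLattice A M) :
    IsFullLattice A' (M.map (e : A →+ A').toIntLinearMap) := by
  refine ⟨hM.1.map _, fun d => ?_⟩
  obtain ⟨k, hk, hkd⟩ := hM.2 (e.symm d)
  refine ⟨k, hk, Submodule.mem_map.2 ⟨_, hkd, ?_⟩⟩
  rw [map_zsmul]
  exact congrArg (fun x : A' => k • x) (e.apply_symm_apply d)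

/-- `M ∼_ε M′ ⟺ ∃ u ∈ A^{unit}, uM = M′` is an equivalence relation on the lattices with any property `p`
(HL Def. 5.1 (a): «`L_1 ∼_ε L_2 :⟺ a ∈ A^{unit}` with `a·L_1 = L_2` exists»). [cite: HertlingLarabi2026b, §5 Def. 5.1 (a), chunk p0009] -/
theorem equivalence_exists_units_smul (p : Submodule ℤ A → Prop) :
    Equivalence fun M M' : {M : Submodule ℤ A // p M} => ∃ u : Aˣ, u • M.1 = M'.1 where
  refl M := ⟨1, one_smul _ _⟩
  symm := by
    rintro M M' ⟨u, hu⟩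
    exact ⟨u⁻¹, by rw [← hu, inv_smul_smul]⟩
  trans := by
    rintro M M' M'' ⟨u, hu⟩ ⟨v, hv⟩
    exact ⟨v * u, by rw [mul_smul, hu, hv]⟩

/-- `e(u • M) = e(u) • e(M)`. [folklore] -/
private theorem map_units_smul (e : A ≃+* A') (u : Aˣ) (M : Submodule ℤ A) :
    (u • M).map (e : A →+ A').toIntLinearMap =
      Units.map (e : A →* A') u • M.map (e : A →+ A').toIntLinearMap := by
  ext y
  simp only [Submodule.mem_map]
  constructor
  · rintro ⟨x, ⟨m, hm, rfl⟩, rfl⟩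
    exact ⟨e m, ⟨m, hm, rfl⟩, by simp⟩
  · rintro ⟨w, ⟨m, hm, rfl⟩, rfl⟩
    exact ⟨u • m, ⟨m, hm, rfl⟩, by simp [Units.smul_def]⟩

/-- `e⁻¹(e(M)) = M`. [folklore] -/
private theorem map_map_symm (e : A ≃+* A') (M : Submodule ℤ A) :
    (M.map (e : A →+ A').toIntLinearMap).map (e.symm : A' →+ A).toIntLinearMap = M := by
  ext x
  simp only [Submodule.mem_map]
  constructor
  · rintro ⟨y, ⟨z, hz, rfl⟩, rfl⟩
    simpa using hz
  · intro hx
    exact ⟨e x, ⟨x, hx, rfl⟩, by simp⟩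

/-- **Transport of finiteness of `ε`-classes.** If `e : A ≃+* A′` maps every lattice with property `P` to one with
property `P′`, and the lattices of `A′` with `P′` fall into finitely many `ε`-classes, then so do the lattices of
`A` with `P`: `[M]_ε ↦ [e(M)]_ε` is well defined and injective (`e(uM) = e(u)e(M)`, `e⁻¹(u′e(M)) = e⁻¹(u′)M`).
(How «it follows easily, using the decomposition `A = ⊕_j A^{(j)}`» is used.) [cite: HertlingLarabi2026b, §4 (before Thm. 4.8) and §5 Cor. 5.4, chunks p0007, p0009] -/
theorem finite_quot_of_ringEquiv (e : A ≃+* A') {P : Submodule ℤ A → Prop} {P' : Submodule ℤ A' → Prop}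
    (hPP' : ∀ M, P M → P' (M.map (e : A →+ A').toIntLinearMap))
    (hfin : Finite (Quot fun M M' : {M : Submodule ℤ A' // P' M} => ∃ u : A'ˣ, u • M.1 = M'.1)) :
    Finite (Quot fun M M' : {M : Submodule ℤ A // P M} => ∃ u : Aˣ, u • M.1 = M'.1) := by
  obtain ⟨F, hF1⟩ : ∃ F : {M : Submodule ℤ A // P M} → {M : Submodule ℤ A' // P' M},
      ∀ M, (F M).1 = M.1.map (e : A →+ A').toIntLinearMap :=
    ⟨fun M => ⟨_, hPP' M.1 M.2⟩, fun M => rfl⟩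
  have hF : ∀ ⦃M₁ M₂ : {M : Submodule ℤ A // P M}⦄, (∃ u : Aˣ, u • M₁.1 = M₂.1) →
      ∃ u' : A'ˣ, u' • (F M₁).1 = (F M₂).1 := by
    rintro M₁ M₂ ⟨u, hu⟩
    refine ⟨Units.map (e : A →* A') u, ?_⟩
    rw [hF1, hF1, ← hu, map_units_smul]
  have hinj : Function.Injective (Quot.map F hF :
      Quot (fun M M' : {M : Submodule ℤ A // P M} => ∃ u : Aˣ, u • M.1 = M'.1) →
        Quot fun M M' : {M : Submodule ℤ A' // P' M} => ∃ u : A'ˣ, u • M.1 = M'.1) := by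
    rintro ⟨M₁⟩ ⟨M₂⟩ h
    obtain ⟨u', hu'⟩ := (equivalence_exists_units_smul P').eqvGen_iff.1 (Quot.eqvGen_exact h)
    refine Quot.sound ⟨Units.map (e.symm : A' →* A) u', ?_⟩
    rw [← map_map_symm e M₁.1, ← map_map_symm e M₂.1, ← hF1, ← hF1, ← hu', map_units_smul]
  exact Finite.of_injective _ hinj

end Transport

/-- Stability transports: if `SM ⊆ M` in a commutative `A`, then `e(M)·e(S) ⊆ e(M)`. [folklore] -/
private theorem forall_mul_mem_map {A A' : Type*} [CommRing A] [Ring A'] (e : A ≃+* A') {S M : Submodule ℤ A}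
    (h : ∀ a ∈ S, ∀ m ∈ M, a * m ∈ M) :
    ∀ m' ∈ M.map (e : A →+ A').toIntLinearMap, ∀ a' ∈ S.map (e : A →+ A').toIntLinearMap,
      m' * a' ∈ M.map (e : A →+ A').toIntLinearMap := by
  rintro m' ⟨m, hm, rfl⟩ a' ⟨a, ha, rfl⟩
  refine ⟨a * m, h a ha m hm, ?_⟩
  rw [mul_comm a m]
  simp

/-! ## §4 (α)⇒(ε): finitely many `ε`-classes of `θ`-stable lattices, finitely many `GLₙ(ℤ)`-classes -/

/-- **A full `θ`-stable lattice makes `θ` integral over `ℤ`**: by Theorem 6.2 (ii) it has a `ℤ`-basis in which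
`μ_θ` is an integer matrix `B` with `minpoly_ℚ B = g`, so `p_B(θ) = 0` with `p_B ∈ ℤ[t]` monic (then
`Λ_g = ℤ[θ]` is an order, cf. «`𝒪(L) ⊃ Λ_f`»). [cite: HertlingLarabi2026b, §6 Thm. 6.2 (ii) and proof, chunks p0012–p0013] -/
theorem isIntegral_root_of_isFullLattice (hg : g.Monic) {L : Submodule ℤ (AdjoinRoot g)}
    (hL : IsFullLattice (AdjoinRoot g) L) (hθ : ∀ x ∈ L, AdjoinRoot.root g * x ∈ L) :
    IsIntegral ℤ (AdjoinRoot.root g) := by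
  obtain ⟨b, B, -, -, hmin⟩ := exists_basis_matrix_of_isFullLattice hg rfl hL hθ
  refine ⟨B.charpoly, Matrix.charpoly_monic B, ?_⟩
  have hdvd : g ∣ (B.charpoly).map (Int.castRingHom ℚ) := by
    have h := Matrix.minpoly_dvd_charpoly (B.map (Int.castRingHom ℚ))
    rwa [hmin, Matrix.charpoly_map] at h
  have h0 : aeval (AdjoinRoot.root g) ((B.charpoly).map (Int.castRingHom ℚ)) = 0 :=
    aeval_eq_zero_of_dvd_aeval_eq_zero hdvd (by rw [AdjoinRoot.aeval_eq, AdjoinRoot.mk_self])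
  rwa [← algebraMap_int_eq ℚ, Polynomial.aeval_map_algebraMap ℚ, aeval_def] at h0

/-- **`Λ_g = ℤ[θ] = ℤ[t]/(g)` is a full lattice (an order) of `A_g` once `θ` is integral** — finitely generated by
integrality, and containing the `ℚ`-basis `1, θ, …, θ^{n−1}` («`A_f := ℚ[t]/(f(t)) ⊃ Λ_f := ℤ[t]/(f(t))`
[…] `Λ_f` is a cyclic order in `A_f`»). [cite: HertlingLarabi2026b, §6 (before Def./Lemma 6.1), chunk p0012] -/
theorem isFullLattice_toSubmodule_adjoin (hg : g.Monic) (hint : IsIntegral ℤ (AdjoinRoot.root g)) :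
    IsFullLattice (AdjoinRoot g)
      (Subalgebra.toSubmodule (Algebra.adjoin ℤ ({AdjoinRoot.root g} : Set (AdjoinRoot g)))) := by
  refine ⟨hint.fg_adjoin_singleton, fun d => ?_⟩
  obtain ⟨k, hk, hkd⟩ := (isFullLattice_span_range_basis (AdjoinRoot.powerBasis hg.ne_zero).basis).2 d
  refine ⟨k, hk, (Submodule.span_le.2 ?_) hkd⟩
  rintro _ ⟨i, rfl⟩
  simp only [PowerBasis.coe_basis, AdjoinRoot.powerBasis_gen, SetLike.mem_coe, Subalgebra.mem_toSubmodule]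
  exact Subalgebra.pow_mem _ (Algebra.self_mem_adjoin_singleton ℤ _) _

/-- **REMARK 6.3 (iv) (α)⇒(ε), lattice side (= Corollary 5.4 for `A = A_g`, `Λ = Λ_g`): for a square-free monic
`g`, the `ε`-classes of full `θ`-stable lattices of `A_g = ℚ[t]/(g)` form a FINITE type.** Proof as printed:
`A_g ≅ ∏_p ℚ[t]/(p)` is a product of number fields (§2), the image of the order `Λ_g` is a full lattice there, and
the `ε`-classes of full lattices `M` with `MΛ ⊆ M` in a product of number fields are finite in number (HL 2026
Thm. 6.3 ∕ Dade–Taussky–Zassenhaus, the tree's `finite_quot_isFullLattice_of_isFullLattice`); classes transport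
injectively (§3). (If no full `θ`-stable lattice exists the type is empty.)
[cite: HertlingLarabi2026b, §6 Rem. 6.3 (iv) and §5 Cor. 5.4, chunks p0013, p0009] [cite: DadeTausskyZassenhaus1962, title theorem] -/
theorem finite_quot_units_smul_of_squarefree (hg : g.Monic) (hsq : Squarefree g) :
    Finite (Quot fun L L' : {L : Submodule ℤ (AdjoinRoot g) //
        IsFullLattice (AdjoinRoot g) L ∧ ∀ x ∈ L, AdjoinRoot.root g * x ∈ L} =>
      ∃ c : (AdjoinRoot g)ˣ, c • L.1 = L'.1) := by
  rcases isEmpty_or_nonempty {L : Submodule ℤ (AdjoinRoot g) //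
      IsFullLattice (AdjoinRoot g) L ∧ ∀ x ∈ L, AdjoinRoot.root g * x ∈ L} with hemp | ⟨⟨L₀, hL₀, hθ₀⟩⟩
  · exact Finite.of_surjective _ Quot.mk_surjective
  have hint : IsIntegral ℤ (AdjoinRoot.root g) := isIntegral_root_of_isFullLattice hg hL₀ hθ₀
  obtain ⟨e⟩ := nonempty_ringEquiv_pi_adjoinRoot hg.ne_zero hsq
  haveI : ∀ i : ↥(normalizedFactors g).toFinset, Fact (Irreducible (i : ℚ[X])) :=
    fun i => ⟨irreducible_coe_toFinset_normalizedFactors i⟩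
  have hfin := Literature.NumberTheory.ComplexMultiplication.finite_quot_isFullLattice_of_isFullLattice
    (L := fun i : ↥(normalizedFactors g).toFinset => AdjoinRoot (i : ℚ[X])) _
    (isFullLattice_map e (isFullLattice_toSubmodule_adjoin hg hint))
  refine finite_quot_of_ringEquiv e (fun M hM => ⟨isFullLattice_map e hM.1, ?_⟩) hfin
  exact forall_mul_mem_map e (forall_adjoin_mul_mem_iff.2 hM.2)

/-- **REMARK 6.3 (iv) (α)⇒(ε): «`S_{1,f}` is finite» — for a square-free monic `g` of degree `n`, the regular
integer `n × n` matrices with characteristic polynomial `g` (`minpoly_ℚ B = g`) lie in finitely many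
`GLₙ(ℤ)`-conjugacy classes**, by Theorem 6.2 (`exists_equiv_quot_conj_quot_units_smul`) and the lattice-side
finiteness. [cite: HertlingLarabi2026b, §6 Rem. 6.3 (iv) (ε), chunk p0013] [cite: LatimerMacduffee1933, as cited by HertlingLarabi2026b Thm. 6.2] -/
theorem finite_quot_conj_of_squarefree (hg : g.Monic) (hdeg : g.natDegree = n) (hsq : Squarefree g) :
    Finite (Quot fun B B' : {B : Matrix (Fin n) (Fin n) ℤ // minpoly ℚ (B.map (Int.castRingHom ℚ)) = g} =>
      ∃ P : Matrix (Fin n) (Fin n) ℤ, IsUnit P.det ∧ P * B.1 = B'.1 * P) := by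
  obtain ⟨Φ, -⟩ := exists_equiv_quot_conj_quot_units_smul hg hdeg
  haveI := finite_quot_units_smul_of_squarefree hg hsq
  exact Finite.of_equiv _ Φ.symm

/-- **THE SQUARE-FREE CASE OF «the set of semisimple matrices in `M_{n×n}(ℤ)` with a fixed characteristic
polynomial splits into finitely many `GL_n(ℤ)`-conjugacy classes»**: for `f ∈ ℤ[t]` monic of degree `n` without
multiple roots (square-free in `ℚ[t]`), the integer `n × n` matrices with characteristic polynomial `f`, modulo
`B′ = PBP⁻¹` (`P ∈ GLₙ(ℤ)`), form a finite type — all of them are regular (§1), and `S_{1,f}` is finite.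
[cite: HertlingLarabi2026b, §1 (consequence of Jordan–Zassenhaus [Za38]) and §6 Rem. 6.3 (iv), chunks p0003, p0013]
[cite: Marseglia2019, Thm. 8.1 (via ANTS XVI §4 Thm. 4.1, chunk p0013)] -/
theorem finite_quot_charpoly_conj_of_squarefree {f : ℤ[X]} (hf : f.Monic) (hdeg : f.natDegree = n)
    (hsq : Squarefree (f.map (Int.castRingHom ℚ))) :
    Finite (Quot fun B B' : {B : Matrix (Fin n) (Fin n) ℤ // B.charpoly = f} =>
      ∃ P : Matrix (Fin n) (Fin n) ℤ, IsUnit P.det ∧ P * B.1 = B'.1 * P) := by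
  have hdeg' : (f.map (Int.castRingHom ℚ)).natDegree = n := by
    rw [Polynomial.natDegree_map_eq_of_injective (Int.castRingHom ℚ).injective_int, hdeg]
  haveI := finite_quot_conj_of_squarefree (hf.map (Int.castRingHom ℚ)) hdeg' hsq
  exact Finite.of_equiv _ (Quot.congr
    (ra := fun B B' : {B : Matrix (Fin n) (Fin n) ℤ //
        minpoly ℚ (B.map (Int.castRingHom ℚ)) = f.map (Int.castRingHom ℚ)} =>
      ∃ P : Matrix (Fin n) (Fin n) ℤ, IsUnit P.det ∧ P * B.1 = B'.1 * P)
    (Equiv.subtypeEquivRight fun B => minpoly_map_eq_iff_charpoly_eq_of_squarefree hdeg hsq B)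
    fun _ _ => Iff.rfl)

/-- The same with hypothesis (β) as printed: **for `f ∈ ℤ[t]` monic of degree `n` which «does not have multiple
roots in `ℂ`», the integer `n × n` matrices with characteristic polynomial `f` lie in finitely many
`GLₙ(ℤ)`-conjugacy classes.** [cite: HertlingLarabi2026b, §6 Rem. 6.3 (iv) (β)⇒(ε), chunk p0013]
[cite: HertlingLarabi2026b, §1 («consequence of the Jordan-Zassenhaus theorem [Za38]»), chunk p0003] -/
theorem finite_quot_charpoly_conj_of_nodup_roots {f : ℤ[X]} (hf : f.Monic) (hdeg : f.natDegree = n)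
    (hβ : (f.map (Int.castRingHom ℂ)).roots.Nodup) :
    Finite (Quot fun B B' : {B : Matrix (Fin n) (Fin n) ℤ // B.charpoly = f} =>
      ∃ P : Matrix (Fin n) (Fin n) ℤ, IsUnit P.det ∧ P * B.1 = B'.1 * P) :=
  finite_quot_charpoly_conj_of_squarefree hf hdeg ((squarefree_map_iff_nodup_roots hf.ne_zero).2 hβ)

/-- … and there is at least one class (that of the companion matrix `M_f`, Rem. 6.3 (iii)): the number
`#S_{1,f} ≥ 1` of `GLₙ(ℤ)`-classes of integer matrices with characteristic polynomial `f` is a positive integer.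
[cite: HertlingLarabi2026b, §6 Rem. 6.3 (iii)–(iv), chunk p0013] -/
theorem natCard_quot_charpoly_conj_pos {f : ℤ[X]} (hf : f.Monic) (hdeg : f.natDegree = n)
    (hsq : Squarefree (f.map (Int.castRingHom ℚ))) :
    0 < Nat.card (Quot fun B B' : {B : Matrix (Fin n) (Fin n) ℤ // B.charpoly = f} =>
      ∃ P : Matrix (Fin n) (Fin n) ℤ, IsUnit P.det ∧ P * B.1 = B'.1 * P) := by
  haveI := finite_quot_charpoly_conj_of_squarefree hf hdeg hsq
  obtain ⟨b, -, -, hmin⟩ := exists_basis_pow_companion hf hdeg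
  haveI : Nonempty (Quot fun B B' : {B : Matrix (Fin n) (Fin n) ℤ // B.charpoly = f} =>
      ∃ P : Matrix (Fin n) (Fin n) ℤ, IsUnit P.det ∧ P * B.1 = B'.1 * P) :=
    ⟨Quot.mk _ ⟨_, ((minpoly_map_eq_iff_charpoly_eq_and_natDegree_eq hdeg _).1 hmin).1⟩⟩
  exact Nat.card_pos

/-! ## §5 (ε)⇒(β): a multiple root gives infinitely many classes (via Remark 5.11 (i)) -/

section Orders

variable {A : Type*} [CommRing A]

open Literature.NumberTheory.Automorphic (mem_units_smul_submodule_iff)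

/-- **`ε`-equivalent orders are equal**: if `uΛ₁ = Λ₂` for a unit `u` and orders `Λ₁`, `Λ₂` (`1 ∈ Λ_i`,
`Λ_iΛ_i ⊆ Λ_i`), then `Λ₁ = Λ₂` (`u = u·1 ∈ Λ₂` and `u² ∈ Λ₂Λ₂ ⊆ uΛ₁` give `u ∈ Λ₁`, so `Λ₂ = uΛ₁ ⊆ Λ₁`;
symmetrically). Used as: distinct orders have distinct `ε`-classes («there are infinitely many orders»
⟹ infinitely many classes). [cite: HertlingLarabi2026b, §5 Def. 5.1 (a) and Rem. 5.11 (i), chunks p0009–p0010] -/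
theorem eq_of_units_smul_eq_of_one_mem {Λ₁ Λ₂ : Submodule ℤ A} (u : Aˣ) (hu : u • Λ₁ = Λ₂)
    (h₁ : (1 : A) ∈ Λ₁) (hm₁ : Λ₁ * Λ₁ ≤ Λ₁) (h₂ : (1 : A) ∈ Λ₂) (hm₂ : Λ₂ * Λ₂ ≤ Λ₂) : Λ₁ = Λ₂ := by
  have hu' : u⁻¹ • Λ₂ = Λ₁ := by rw [← hu, inv_smul_smul]
  -- `v = v•1 ∈ vΛ`, and `v·v ∈ (vΛ)(vΛ) ⊆ vΛ` gives `v ∈ Λ`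
  have key : ∀ (v : Aˣ) (Λ Λ' : Submodule ℤ A), v • Λ = Λ' → (1 : A) ∈ Λ → Λ' * Λ' ≤ Λ' → (v : A) ∈ Λ := by
    intro v Λ Λ' hv h1 hm
    have hvΛ' : (v : A) ∈ Λ' := by
      rw [← hv, mem_units_smul_submodule_iff, Units.smul_def, smul_eq_mul, Units.inv_mul]
      exact h1
    have h := hm (Submodule.mul_mem_mul hvΛ' hvΛ')
    rw [← hv, mem_units_smul_submodule_iff, Units.smul_def, smul_eq_mul, ← mul_assoc, Units.inv_mul,
      one_mul] at h
    exact h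
  have hu₁ : (u : A) ∈ Λ₁ := key u Λ₁ Λ₂ hu h₁ hm₂
  have hu₂ : ((u⁻¹ : Aˣ) : A) ∈ Λ₂ := key u⁻¹ Λ₂ Λ₁ hu' h₂ hm₁
  refine le_antisymm (fun x hx => ?_) (fun x hx => ?_)
  · rw [← hu'] at hx
    obtain ⟨y, hy, rfl⟩ := (Submodule.mem_smul_pointwise_iff_exists _ _ _).1 hx
    rw [Units.smul_def, smul_eq_mul]
    exact hm₂ (Submodule.mul_mem_mul hu₂ hy)
  · rw [← hu] at hx
    obtain ⟨y, hy, rfl⟩ := (Submodule.mem_smul_pointwise_iff_exists _ _ _).1 hx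
    rw [Units.smul_def, smul_eq_mul]
    exact hm₁ (Submodule.mul_mem_mul hu₁ hy)

/-- **Remark 5.11 (i)-type orders: for an order `Λ` and `x` with `x² = 0`, `Λ + xΛ` is again multiplicatively
closed** (`(Λ + xΛ)² = Λ² + xΛ² + x²Λ² ⊆ Λ + xΛ`). HL's sequence is `Λ_m := Λ + Σ_l 2^{-lm}(Λ ∩ R)^l`; with a
single `x ∈ R`, `x² = 0`, the sum stops at `l = 1`. [cite: HertlingLarabi2026b, §5 Rem. 5.11 (i) (5.18), chunk p0010] -/
theorem sup_span_mul_mul_le {Λ : Submodule ℤ A} (hΛ : Λ * Λ ≤ Λ) {x : A} (hx : x * x = 0) :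
    (Λ ⊔ span ℤ {x} * Λ) * (Λ ⊔ span ℤ {x} * Λ) ≤ Λ ⊔ span ℤ {x} * Λ := by
  have hSS : span ℤ {x} * span ℤ {x} = (⊥ : Submodule ℤ A) := by
    rw [Submodule.span_mul_span, Set.singleton_mul_singleton, hx, Submodule.span_singleton_eq_bot]
  rw [Submodule.mul_sup, Submodule.sup_mul, Submodule.sup_mul]
  refine sup_le (sup_le (hΛ.trans le_sup_left) ?_) (sup_le ?_ ?_)
  · rw [mul_assoc]
    exact (mul_le_mul' le_rfl hΛ).trans le_sup_right
  · rw [mul_left_comm]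
    exact (mul_le_mul' le_rfl hΛ).trans le_sup_right
  · rw [mul_mul_mul_comm, hSS, Submodule.bot_mul]
    exact bot_le

/-- A full lattice cannot contain `2^{-k} r` for all large `k` unless `r = 0` (coordinates in a `ℤ`-basis would be
rationals divisible by every power of `2`). [folklore] -/
private theorem eq_zero_of_forall_inv_pow_smul_mem {A : Type} [CommRing A] [Algebra ℚ A] [Module.Finite ℚ A]
    {L : Submodule ℤ A} (hL : IsFullLattice A L) {r : A} {K : ℕ}
    (h : ∀ k, K ≤ k → ((2 : ℚ) ^ k)⁻¹ • r ∈ L) : r = 0 := by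
  obtain ⟨b, hb⟩ := Literature.NumberTheory.ComplexMultiplication.FiniteQAlgebraLattice.exists_basis_fin_span_eq hL
  refine b.ext_elem fun i => ?_
  rw [map_zero, Finsupp.zero_apply]
  by_contra hne
  obtain ⟨N, hN⟩ := pow_unbounded_of_one_lt |b.repr r i| (by norm_num : (1 : ℚ) < 2)
  have hmem := h (max K N) (le_max_left _ _)
  rw [← hb, Basis.mem_span_iff_repr_mem] at hmem
  obtain ⟨z, hz⟩ := hmem i
  rw [map_smul, Finsupp.smul_apply, smul_eq_mul] at hz
  -- `b.repr r i = z · 2^k` with `z ≠ 0`, so `|b.repr r i| ≥ 2^k ≥ 2^N`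
  have h2 : (0 : ℚ) < (2 : ℚ) ^ max K N := pow_pos (by norm_num) _
  have hz' : (z : ℚ) = ((2 : ℚ) ^ max K N)⁻¹ * b.repr r i := by
    rw [← eq_intCast (algebraMap ℤ ℚ) z]
    exact hz
  have hc : b.repr r i = (z : ℚ) * (2 : ℚ) ^ max K N := by
    rw [hz', mul_comm (((2 : ℚ) ^ max K N)⁻¹) (b.repr r i), inv_mul_cancel_right₀ h2.ne']
  have hz0 : z ≠ 0 := by
    rintro rfl
    rw [Int.cast_zero, zero_mul] at hc
    exact hne hc
  have h1 : (1 : ℚ) ≤ |(z : ℚ)| := by exact_mod_cast Int.one_le_abs hz0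
  have hle : (2 : ℚ) ^ N ≤ |b.repr r i| := by
    rw [hc, abs_mul, abs_of_pos h2]
    calc (2 : ℚ) ^ N ≤ (2 : ℚ) ^ max K N := pow_le_pow_right₀ (by norm_num) (le_max_right _ _)
      _ = 1 * (2 : ℚ) ^ max K N := (one_mul _).symm
      _ ≤ |(z : ℚ)| * (2 : ℚ) ^ max K N := mul_le_mul_of_nonneg_right h1 h2.le
  exact absurd hN (not_lt.2 hle)

end Orders

/-- **(β) fails ⟹ a nonzero `r ∈ A_g` with `r² = 0`** («`A_f` is separable ⟺ `f` does not have multiple roots»: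
if `g = p²q` with `deg p ≥ 1` then `r = [pq] ≠ 0`, `r² = [g·q²] = 0`, so `R = Rad(A_g) ≠ 0`).
[cite: HertlingLarabi2026b, §6 Rem. 6.3 (iv) (α)⟺(β), chunk p0013] -/
theorem exists_ne_zero_mul_self_eq_zero (hg : g.Monic) (hnsq : ¬Squarefree g) :
    ∃ r : AdjoinRoot g, r ≠ 0 ∧ r * r = 0 := by
  simp only [Squarefree, not_forall] at hnsq
  obtain ⟨p, ⟨q, hq⟩, hpu⟩ := hnsq
  have hp0 : p ≠ 0 := by
    rintro rfl
    rw [zero_mul, zero_mul] at hq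
    exact hg.ne_zero hq
  have hq0 : q ≠ 0 := by
    rintro rfl
    rw [mul_zero] at hq
    exact hg.ne_zero hq
  have hdp : 0 < p.natDegree :=
    Polynomial.natDegree_pos_iff_degree_pos.2 (Polynomial.degree_pos_of_ne_zero_of_nonunit hp0 hpu)
  refine ⟨AdjoinRoot.mk g (p * q), fun h0 => ?_, ?_⟩
  · rw [AdjoinRoot.mk_eq_zero] at h0
    have hlt : (p * q).natDegree < g.natDegree := by
      rw [hq, Polynomial.natDegree_mul (mul_ne_zero hp0 hp0) hq0, Polynomial.natDegree_mul hp0 hq0,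
        Polynomial.natDegree_mul hp0 hp0]
      omega
    exact mul_ne_zero hp0 hq0 (Polynomial.eq_zero_of_dvd_of_natDegree_lt h0 hlt)
  · rw [← map_mul, AdjoinRoot.mk_eq_zero]
    exact ⟨q, by rw [hq]; ring⟩

/-- For `f ∈ ℤ[t]` monic, `θ = t̄ ∈ A_f = ℚ[t]/(f)` is integral over `ℤ` (`Λ_f = ℤ[t]/(f)` is an order).
[cite: HertlingLarabi2026b, §6 (before Def./Lemma 6.1), chunk p0012] -/
theorem isIntegral_root_map {f : ℤ[X]} (hf : f.Monic) :
    IsIntegral ℤ (AdjoinRoot.root (f.map (Int.castRingHom ℚ))) :=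
  ⟨f, hf, by rw [← aeval_def, ← Polynomial.aeval_map_algebraMap ℚ, algebraMap_int_eq,
    AdjoinRoot.aeval_eq, AdjoinRoot.mk_self]⟩

/-- **REMARK 6.3 (iv) (ε)⇒(α), lattice side: if the monic `g` (with `θ` integral over `ℤ`) has a multiple root,
the `ε`-classes of full `θ`-stable lattices of `A_g` form an INFINITE type.** As printed, «Remark 5.11 (i) is
needed»: `R ∋ r ≠ 0`, `r² = 0`, `r ∈ Λ_g` (scaled), and the orders `Λ_m := Λ_g + 2^{-m} r Λ_g ⊇ Λ_g` are
pairwise `ε`-inequivalent unless equal; they are not eventually equal since no full lattice contains all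
`2^{-m} r`. [cite: HertlingLarabi2026b, §6 Rem. 6.3 (iv) and §5 Rem. 5.11 (i), chunks p0013, p0010] -/
theorem infinite_quot_units_smul_of_not_squarefree (hg : g.Monic) (hint : IsIntegral ℤ (AdjoinRoot.root g))
    (hnsq : ¬Squarefree g) :
    Infinite (Quot fun L L' : {L : Submodule ℤ (AdjoinRoot g) //
        IsFullLattice (AdjoinRoot g) L ∧ ∀ x ∈ L, AdjoinRoot.root g * x ∈ L} =>
      ∃ c : (AdjoinRoot g)ˣ, c • L.1 = L'.1) := by
  haveI : Module.Finite ℚ (AdjoinRoot g) := (AdjoinRoot.powerBasis hg.ne_zero).finite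
  -- the order `Λ = Λ_g = ℤ[θ]`
  obtain ⟨Λ, hΛdef⟩ : ∃ Λ : Submodule ℤ (AdjoinRoot g),
      Λ = Subalgebra.toSubmodule (Algebra.adjoin ℤ ({AdjoinRoot.root g} : Set (AdjoinRoot g))) := ⟨_, rfl⟩
  have hΛfull : IsFullLattice (AdjoinRoot g) Λ := hΛdef ▸ isFullLattice_toSubmodule_adjoin hg hint
  have h1 : (1 : AdjoinRoot g) ∈ Λ := hΛdef ▸ Subalgebra.one_mem _
  have hθ : AdjoinRoot.root g ∈ Λ := hΛdef ▸ Algebra.self_mem_adjoin_singleton ℤ _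
  have hΛΛ : Λ * Λ ≤ Λ := by
    rw [hΛdef]
    exact Submodule.mul_le.2 fun a ha b hb => Subalgebra.mul_mem _ ha hb
  -- a nilpotent `r ∈ Λ`, `r ≠ 0`, `r² = 0`
  obtain ⟨r₀, hr₀, hr₀2⟩ := exists_ne_zero_mul_self_eq_zero hg hnsq
  obtain ⟨N, hN, hNr⟩ := hΛfull.2 r₀
  have hr : N • r₀ ≠ 0 := fun h0 => by
    rw [← Int.cast_smul_eq_zsmul ℚ] at h0
    exact hr₀ ((smul_eq_zero.1 h0).resolve_left (Int.cast_ne_zero.2 hN))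
  have hr2 : (N • r₀) * (N • r₀) = 0 := by
    rw [smul_mul_assoc, mul_smul_comm, hr₀2, smul_zero, smul_zero]
  -- the orders `Λ_k := Λ + 2^{-k} r Λ`
  obtain ⟨x, hxdef⟩ : ∃ x : ℕ → AdjoinRoot g, ∀ k, x k = ((2 : ℚ) ^ k)⁻¹ • (N • r₀) := ⟨_, fun k => rfl⟩
  obtain ⟨M, hMdef⟩ : ∃ M : ℕ → Submodule ℤ (AdjoinRoot g), ∀ k, M k = Λ ⊔ span ℤ {x k} * Λ :=
    ⟨_, fun k => rfl⟩
  have hord : ∀ k, (1 : AdjoinRoot g) ∈ M k ∧ M k * M k ≤ M k := fun k => by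
    rw [hMdef]
    refine ⟨le_sup_left (b := span ℤ {x k} * Λ) h1, sup_span_mul_mul_le hΛΛ ?_⟩
    rw [hxdef, smul_mul_assoc, mul_smul_comm, hr2, smul_zero, smul_zero]
  have hP : ∀ k, IsFullLattice (AdjoinRoot g) (M k) ∧ ∀ y ∈ M k, AdjoinRoot.root g * y ∈ M k := fun k => by
    have hle : Λ ≤ M k := by rw [hMdef]; exact le_sup_left
    refine ⟨⟨?_, fun d => ?_⟩, fun y hy => (hord k).2 (Submodule.mul_mem_mul (hle hθ) hy)⟩
    · rw [hMdef]
      exact hΛfull.1.sup ((Submodule.fg_span_singleton _).mul hΛfull.1)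
    · obtain ⟨n, hn, hnd⟩ := hΛfull.2 d
      exact ⟨n, hn, hle hnd⟩
  have hxmem : ∀ k, x k ∈ M k := fun k => by
    rw [hMdef]
    refine le_sup_right (a := Λ) ?_
    have h := Submodule.mul_mem_mul (Submodule.mem_span_singleton_self (x k)) h1
    rwa [mul_one] at h
  have hmono : Monotone M := by
    refine monotone_nat_of_le_succ fun k => ?_
    rw [hMdef, hMdef]
    refine sup_le_sup_left (mul_le_mul' ((Submodule.span_singleton_le_iff_mem _ _).2 ?_) le_rfl) _
    have h2 : (2 : ℚ) * ((2 : ℚ) ^ (k + 1))⁻¹ = ((2 : ℚ) ^ k)⁻¹ := by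
      rw [pow_succ, mul_inv, mul_comm, mul_assoc, inv_mul_cancel₀ (two_ne_zero' ℚ), mul_one]
    have hx : x k = (2 : ℤ) • x (k + 1) := by
      rw [hxdef, hxdef, two_zsmul, ← add_smul, ← two_mul, h2]
    rw [hx]
    exact Submodule.smul_mem _ _ (Submodule.mem_span_singleton_self _)
  -- suppose there were finitely many classes
  rw [← not_finite_iff_infinite]
  intro hfin
  obtain ⟨y, hy⟩ := Finite.exists_infinite_fiber fun k : ℕ =>
    Quot.mk (fun L L' : {L : Submodule ℤ (AdjoinRoot g) //
        IsFullLattice (AdjoinRoot g) L ∧ ∀ x ∈ L, AdjoinRoot.root g * x ∈ L} =>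
      ∃ c : (AdjoinRoot g)ˣ, c • L.1 = L'.1) ⟨M k, hP k⟩
  have hinf := Set.infinite_coe_iff.1 hy
  obtain ⟨k₀, hk₀⟩ := hinf.nonempty
  -- all orders in the fibre coincide with `M k₀`
  have heq : ∀ k, Quot.mk (fun L L' : {L : Submodule ℤ (AdjoinRoot g) //
        IsFullLattice (AdjoinRoot g) L ∧ ∀ x ∈ L, AdjoinRoot.root g * x ∈ L} =>
      ∃ c : (AdjoinRoot g)ˣ, c • L.1 = L'.1) ⟨M k, hP k⟩ = y → M k = M k₀ := fun k hk => by
    have hkk := hk.trans (Set.mem_singleton_iff.1 (Set.mem_preimage.1 hk₀)).symm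
    obtain ⟨u, hu⟩ := (equivalence_exists_units_smul _).eqvGen_iff.1 (Quot.eqvGen_exact hkk)
    exact eq_of_units_smul_eq_of_one_mem u hu (hord k).1 (hord k).2 (hord k₀).1 (hord k₀).2
  -- hence `2^{-k} r ∈ M k₀` for every `k`
  have hall : ∀ k, 0 ≤ k → ((2 : ℚ) ^ k)⁻¹ • (N • r₀) ∈ M k₀ := fun k _ => by
    obtain ⟨k', hk', hkk'⟩ := hinf.exists_gt k
    rw [← hxdef, ← heq k' (Set.mem_singleton_iff.1 (Set.mem_preimage.1 hk'))]
    exact hmono hkk'.le (hxmem k)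
  exact hr (eq_zero_of_forall_inv_pow_smul_mem (hP k₀).1 hall)

/-- **REMARK 6.3 (iv) (ε)⇒(β) for matrices: if `f ∈ ℤ[t]` (monic, degree `n`) HAS a multiple root, the regular
integer matrices with characteristic polynomial `f` lie in INFINITELY many `GLₙ(ℤ)`-conjugacy classes**
(`S_{1,f}` is infinite; «If the conditions in (iv) do not hold, it is a union of infinitely many finite sets»).
[cite: HertlingLarabi2026b, §6 Rem. 6.3 (iv)–(v), chunk p0013] -/
theorem infinite_quot_conj_of_not_squarefree {f : ℤ[X]} (hf : f.Monic) (hdeg : f.natDegree = n)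
    (hnsq : ¬Squarefree (f.map (Int.castRingHom ℚ))) :
    Infinite (Quot fun B B' : {B : Matrix (Fin n) (Fin n) ℤ //
        minpoly ℚ (B.map (Int.castRingHom ℚ)) = f.map (Int.castRingHom ℚ)} =>
      ∃ P : Matrix (Fin n) (Fin n) ℤ, IsUnit P.det ∧ P * B.1 = B'.1 * P) := by
  have hdeg' : (f.map (Int.castRingHom ℚ)).natDegree = n := by
    rw [Polynomial.natDegree_map_eq_of_injective (Int.castRingHom ℚ).injective_int, hdeg]
  obtain ⟨Φ, -⟩ := exists_equiv_quot_conj_quot_units_smul (hf.map (Int.castRingHom ℚ)) hdeg'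
  haveI := infinite_quot_units_smul_of_not_squarefree (hf.map _) (isIntegral_root_map hf) hnsq
  exact Infinite.of_injective _ Φ.symm.injective

/-- **REMARK 6.3 (iv) (β)⟺(ε): for `f ∈ ℤ[t]` monic of degree `n`, `S_{1,f}` (the `GLₙ(ℤ)`-classes of regular
integer matrices with characteristic polynomial `f`) is finite iff `f` has no multiple roots.**
[cite: HertlingLarabi2026b, §6 Rem. 6.3 (iv), chunk p0013] -/
theorem finite_quot_conj_iff_squarefree {f : ℤ[X]} (hf : f.Monic) (hdeg : f.natDegree = n) :
    Finite (Quot fun B B' : {B : Matrix (Fin n) (Fin n) ℤ //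
        minpoly ℚ (B.map (Int.castRingHom ℚ)) = f.map (Int.castRingHom ℚ)} =>
      ∃ P : Matrix (Fin n) (Fin n) ℤ, IsUnit P.det ∧ P * B.1 = B'.1 * P) ↔
      Squarefree (f.map (Int.castRingHom ℚ)) := by
  refine ⟨fun h => ?_, fun hsq => ?_⟩
  · by_contra hnsq
    exact not_finite_iff_infinite.2 (infinite_quot_conj_of_not_squarefree hf hdeg hnsq) h
  · have hdeg' : (f.map (Int.castRingHom ℚ)).natDegree = n := by
      rw [Polynomial.natDegree_map_eq_of_injective (Int.castRingHom ℚ).injective_int, hdeg]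
    exact finite_quot_conj_of_squarefree (hf.map _) hdeg' hsq

/-- The same with (β) read in `ℂ`: **`S_{1,f}` is finite iff `f` does not have multiple roots in `ℂ`.**
[cite: HertlingLarabi2026b, §6 Rem. 6.3 (iv) (β)⟺(ε), chunk p0013] -/
theorem finite_quot_conj_iff_nodup_roots {f : ℤ[X]} (hf : f.Monic) (hdeg : f.natDegree = n) :
    Finite (Quot fun B B' : {B : Matrix (Fin n) (Fin n) ℤ //
        minpoly ℚ (B.map (Int.castRingHom ℚ)) = f.map (Int.castRingHom ℚ)} =>
      ∃ P : Matrix (Fin n) (Fin n) ℤ, IsUnit P.det ∧ P * B.1 = B'.1 * P) ↔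
      (f.map (Int.castRingHom ℂ)).roots.Nodup := by
  rw [finite_quot_conj_iff_squarefree hf hdeg, squarefree_map_iff_nodup_roots hf.ne_zero]

/-! ## §6 (α)⟺(β)⟺(γ)⟺(δ)⟺(ε): separability, semisimplicity, finiteness -/

/-- **REMARK 6.3 (iv) (α)⟺(β): «`A_f` is separable» ⟺ «`f` does not have multiple roots»** — for a monic `g`,
`A_g = ℚ[t]/(g)` is reduced (radical `R = 0`, HL26b Thm. 3.1 (iii)) iff `g` is square-free: a product of fields
for square-free `g` (§2), a nonzero `r` with `r² = 0` otherwise (§5).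
[cite: HertlingLarabi2026b, §6 Rem. 6.3 (iv) (α)⟺(β), chunk p0013; §3 Thm. 3.1 (iii), chunk p0006] -/
theorem isReduced_adjoinRoot_iff_squarefree (hg : g.Monic) : IsReduced (AdjoinRoot g) ↔ Squarefree g := by
  refine ⟨fun h => by_contra fun hnsq => ?_, fun hsq => ?_⟩
  · obtain ⟨r, hr, hr2⟩ := exists_ne_zero_mul_self_eq_zero hg hnsq
    exact hr (h.eq_zero r ⟨2, by rw [pow_two, hr2]⟩)
  · obtain ⟨e⟩ := nonempty_ringEquiv_pi_adjoinRoot hg.ne_zero hsq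
    haveI : ∀ i : ↥(normalizedFactors g).toFinset, Fact (Irreducible (i : ℚ[X])) :=
      fun i => ⟨irreducible_coe_toFinset_normalizedFactors i⟩
    exact isReduced_of_injective e e.injective

/-- **REMARK 6.3 (iv) (γ)⟺(β): «`M_f` is semisimple» ⟺ «`f` does not have multiple roots»** — the companion matrix
is regular (`minpoly_ℚ M_f = f`, Rem. 6.3 (iii)), and an endomorphism is semisimple iff its minimal polynomial is
square-free (Hoffman–Kunze §7.5 Thm. 11, the tree's `isSemisimple_iff_squarefree_minpoly`).
[cite: HertlingLarabi2026b, §6 Rem. 6.3 (iv) (β)⟺(γ) and Def./Lemma 6.1 (d), chunks p0012–p0013] -/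
theorem isSemisimple_companion_iff_squarefree {f : ℤ[X]} (hf : f.Monic) (hdeg : f.natDegree = n) :
    Module.End.IsSemisimple (Matrix.toLin' (((Literature.LinearAlgebra.Matrix.companion
        (fun i : Fin n => f.coeff i) : Matrix (Fin n) (Fin n) ℤ)).map (Int.castRingHom ℚ))) ↔
      Squarefree (f.map (Int.castRingHom ℚ)) := by
  obtain ⟨b, -, -, hmin⟩ := exists_basis_pow_companion hf hdeg
  rw [Literature.LinearAlgebra.isSemisimple_iff_squarefree_minpoly, Matrix.minpoly_toLin', hmin]

/-- **REMARK 6.3 (iv) (δ)⟺(β): «Any regular matrix in `M_{n×n}(ℤ)` with characteristic polynomial `f` is semisimple»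
⟺ «`f` does not have multiple roots»** (a regular `B` has `minpoly_ℚ B = f`; ⟹ by the companion matrix).
[cite: HertlingLarabi2026b, §6 Rem. 6.3 (iv) (β)⟺(δ), chunk p0013] -/
theorem forall_isSemisimple_iff_squarefree {f : ℤ[X]} (hf : f.Monic) (hdeg : f.natDegree = n) :
    (∀ B : Matrix (Fin n) (Fin n) ℤ, minpoly ℚ (B.map (Int.castRingHom ℚ)) = f.map (Int.castRingHom ℚ) →
        Module.End.IsSemisimple (Matrix.toLin' (B.map (Int.castRingHom ℚ)))) ↔
      Squarefree (f.map (Int.castRingHom ℚ)) := by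
  constructor
  · intro h
    obtain ⟨b, -, -, hmin⟩ := exists_basis_pow_companion hf hdeg
    have hs := h _ hmin
    rw [Literature.LinearAlgebra.isSemisimple_iff_squarefree_minpoly, Matrix.minpoly_toLin', hmin] at hs
    exact hs
  · intro hsq B hB
    rw [Literature.LinearAlgebra.isSemisimple_iff_squarefree_minpoly, Matrix.minpoly_toLin', hB]
    exact hsq

/-- **REMARK 6.3 (iv) IN FULL: «The following conditions are equivalent: (α) `A_f` is separable. (β) `f` does not have
multiple roots in `ℂ`. (γ) `M_f` is semisimple. (δ) Any regular matrix in `M_{n×n}(ℤ)` with characteristic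
polynomial `f` is semisimple. (ε) `S_{1,f}` is finite.»** — for `f ∈ ℤ[t]` monic of degree `n`; (β) is stated as
square-freeness over `ℚ` (⟺ no multiple roots in `ℂ`, `squarefree_map_iff_nodup_roots`).
[cite: HertlingLarabi2026b, §6 Rem. 6.3 (iv), chunk p0013] -/
theorem isReduced_squarefree_isSemisimple_finite_tfae {f : ℤ[X]} (hf : f.Monic) (hdeg : f.natDegree = n) :
    List.TFAE [IsReduced (AdjoinRoot (f.map (Int.castRingHom ℚ))),
      Squarefree (f.map (Int.castRingHom ℚ)),
      Module.End.IsSemisimple (Matrix.toLin' (((Literature.LinearAlgebra.Matrix.companion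
          (fun i : Fin n => f.coeff i) : Matrix (Fin n) (Fin n) ℤ)).map (Int.castRingHom ℚ))),
      ∀ B : Matrix (Fin n) (Fin n) ℤ, minpoly ℚ (B.map (Int.castRingHom ℚ)) = f.map (Int.castRingHom ℚ) →
        Module.End.IsSemisimple (Matrix.toLin' (B.map (Int.castRingHom ℚ))),
      Finite (Quot fun B B' : {B : Matrix (Fin n) (Fin n) ℤ //
          minpoly ℚ (B.map (Int.castRingHom ℚ)) = f.map (Int.castRingHom ℚ)} =>
        ∃ P : Matrix (Fin n) (Fin n) ℤ, IsUnit P.det ∧ P * B.1 = B'.1 * P)] := by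
  tfae_have 1 ↔ 2 := isReduced_adjoinRoot_iff_squarefree (hf.map _)
  tfae_have 3 ↔ 2 := isSemisimple_companion_iff_squarefree hf hdeg
  tfae_have 4 ↔ 2 := forall_isSemisimple_iff_squarefree hf hdeg
  tfae_have 5 ↔ 2 := finite_quot_conj_iff_squarefree hf hdeg
  tfae_finish

end Literature.LinearAlgebra.Matrix.LatimerMacDuffeeSquarefree
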